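/-
Copyright (c) 2026 the pub-hodgecm-mathlib formalisation cell (harness21).  Prover seat hodgecm-mathlib-K2E5-p16 (g5): Track B «K2-LIT»,
hLiu418 = stmt-HodgeConjecture-24832, ROAD Φ junction `K2LiuKFiniteSectionWhittakerHolomorphyGrowth`, file (S): the letters of the bridge
direction `Ξ = h^{−½} Θ h^{−½}` of K2Liu-p05 (g4)'s (V-4) — the scalar jets `(d∕dτ)^i det(1 + τΞ)^{w(s)}|₀` (holomorphic in `s`, growth
polynomial in `S(Ξ)`) and the size bound `S(Ξ) ≤ 4 S(Θ) tr h ∕ det h`; 2026-09-04.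
-/
import Summits.HodgeConjecture.HodgeConjecture.Theorems.K2LiuHolomorphicJetsOfParameter     -- (E): jets engine
import Literature.NumberTheory.Weil1964.ArchUnitaryBallTransitive                           -- ★ `CFC.sqrt` helpers
import Mathlib.Analysis.SpecialFunctions.Pow.Deriv
import Mathlib.Analysis.Matrix.Order
import HarnessLib

/-!
# Crux `HLiu418`, ROAD Φ — file (S): letters of the bridge direction `Ξ = h^{−½} Θ h^{−½}`

Cell `hodgecm-mathlib`, crux item hLiu418 = `stmt-HodgeConjecture-24832`, route of record `HCCMUnconditional`; squad K2, LEAD F0P6-plan (g13),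
prover K2E5-p16 (g5).  THEOREMS ONLY; lane `--supports stmt-HodgeConjecture-24832 --as helper`.  Throughout `S(Ξ) = ‖Ξ₀₀‖ + ‖Ξ₁₀‖ + ‖Ξ₀₁‖ + ‖Ξ₁₁‖`.

* §1 `det_one_add_smul`: `det(1 + τΞ) = 1 + τ tr Ξ + τ² det Ξ` (2×2); for `‖τ‖ ≤ 1∕(4(1 + S(Ξ)))`: `‖det(1 + τΞ) − 1‖ ≤ ½`, so the determinant
  stays in the slit plane with `‖det(1+τΞ)^w‖ ≤ e^{3‖w‖}` (`norm_cpow_le_exp_of_near_one`).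
* §2 THE SCALAR JETS: for an entire exponent map `w`, `s ↦ (d∕dτ)^i det(1 + τΞ)^{w(s)} |₀` is ENTIRE (`differentiable_iteratedDeriv_detPow`, by (E)),
  and `‖(d∕dτ)^i det(1 + τΞ)^{c}|₀‖ ≤ i! · e^{3‖c‖} · (8(1 + S(Ξ)))^i` (`norm_iteratedDeriv_detPow_le`, Cauchy on `‖τ‖ = 1∕(8(1+S))`).
* §3 THE SIZE OF THE BRIDGE DIRECTION: for `h > 0` (2×2) and any `Θ`, `S((√h)⁻¹ Θ (√h)⁻¹) ≤ 4 · S(Θ) · tr h ∕ det h`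
  (`entrySum_bridgeDir_le`; `P = (√h)⁻¹` is hermitian with `P² = h⁻¹`, `Σ‖P_{ab}‖² = tr h⁻¹ = tr h ∕ det h`, Cauchy–Schwarz).
HONEST LABEL.  Count-neutral helper of the K2_Liu road; it pays no socket by itself: `HC_CM` is proved only modulo the 7 printed citations
(2 remaining named inputs: hLiu418 = `stmt-HodgeConjecture-24832`, h413 = `stmt-HodgeConjecture-24833`) until rung 0 closes.
-/

set_option autoImplicit false
-- the mandated namespace repeats the single-problem summit's segment (`HodgeConjecture.HodgeConjecture`)
set_option linter.dupNamespace false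

noncomputable section

open Complex Matrix Set
open scoped ComplexOrder ComplexConjugate Matrix MatrixOrder
open Literature.NumberTheory.Weil1964.UnitaryBall (sqrt_mul_sqrt_of_posDef conjTranspose_sqrt)

namespace Summit.HodgeConjecture.HodgeConjecture.Cruxes.HLiu418.K2LiuBridgeDirectionLetters

open Summit.HodgeConjecture.HodgeConjecture.Cruxes.HLiu418.K2LiuHolomorphicJetsOfParameter

/-! ## §1 `det(1 + τΞ)` near `τ = 0` -/

/-- `det(1 + τΞ) = 1 + τ tr Ξ + τ² det Ξ` (2×2). [folklore] -/
theorem det_one_add_smul (Ξ : Matrix (Fin 2) (Fin 2) ℂ) (τ : ℂ) :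
    (1 + τ • Ξ).det = 1 + τ * Ξ.trace + τ ^ 2 * Ξ.det := by
  rw [det_fin_two, det_fin_two, trace_fin_two]
  simp [Matrix.add_apply, Matrix.smul_apply]
  ring

/-- `‖tr Ξ‖ ≤ S(Ξ)` and `‖det Ξ‖ ≤ S(Ξ)²`. [folklore] -/
theorem norm_trace_det_le (Ξ : Matrix (Fin 2) (Fin 2) ℂ) :
    ‖Ξ.trace‖ ≤ ‖Ξ 0 0‖ + ‖Ξ 1 0‖ + ‖Ξ 0 1‖ + ‖Ξ 1 1‖ ∧ ‖Ξ.det‖ ≤ (‖Ξ 0 0‖ + ‖Ξ 1 0‖ + ‖Ξ 0 1‖ + ‖Ξ 1 1‖) ^ 2 := by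
  refine ⟨?_, ?_⟩
  · rw [trace_fin_two]
    refine (norm_add_le _ _).trans ?_
    linarith [norm_nonneg (Ξ 1 0), norm_nonneg (Ξ 0 1)]
  · rw [det_fin_two]
    refine (norm_sub_le _ _).trans ?_
    rw [norm_mul, norm_mul]
    nlinarith [norm_nonneg (Ξ 0 0), norm_nonneg (Ξ 1 0), norm_nonneg (Ξ 0 1), norm_nonneg (Ξ 1 1),
      mul_nonneg (norm_nonneg (Ξ 0 0)) (norm_nonneg (Ξ 1 0)), mul_nonneg (norm_nonneg (Ξ 0 1)) (norm_nonneg (Ξ 1 1))]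

/-- On the disc `‖τ‖ ≤ 1∕(4(1 + S(Ξ)))`: `‖det(1 + τΞ) − 1‖ ≤ ½`. [folklore] -/
theorem norm_det_one_add_smul_sub_one_le (Ξ : Matrix (Fin 2) (Fin 2) ℂ) {τ : ℂ}
    (hτ : ‖τ‖ ≤ 1 / (4 * (1 + (‖Ξ 0 0‖ + ‖Ξ 1 0‖ + ‖Ξ 0 1‖ + ‖Ξ 1 1‖)))) : ‖(1 + τ • Ξ).det - 1‖ ≤ 1 / 2 := by
  set S : ℝ := ‖Ξ 0 0‖ + ‖Ξ 1 0‖ + ‖Ξ 0 1‖ + ‖Ξ 1 1‖ with hS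
  have hS0 : 0 ≤ S := by positivity
  obtain ⟨htr, hdet⟩ := norm_trace_det_le Ξ
  have hτ0 : 0 ≤ ‖τ‖ := norm_nonneg _
  have h1 : ‖τ‖ * S ≤ 1 / 4 := by
    calc ‖τ‖ * S ≤ 1 / (4 * (1 + S)) * S := mul_le_mul_of_nonneg_right hτ hS0
      _ ≤ 1 / 4 := by rw [div_mul_eq_mul_div, div_le_iff₀ (by positivity)]; nlinarith
  rw [det_one_add_smul, show 1 + τ * Ξ.trace + τ ^ 2 * Ξ.det - 1 = τ * Ξ.trace + τ ^ 2 * Ξ.det by ring]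
  refine (norm_add_le _ _).trans ?_
  rw [norm_mul, norm_mul, norm_pow]
  have h2 : ‖τ‖ * ‖Ξ.trace‖ ≤ 1 / 4 := (mul_le_mul_of_nonneg_left htr hτ0).trans h1
  have h3 : ‖τ‖ ^ 2 * ‖Ξ.det‖ ≤ 1 / 16 := by
    calc ‖τ‖ ^ 2 * ‖Ξ.det‖ ≤ ‖τ‖ ^ 2 * S ^ 2 := mul_le_mul_of_nonneg_left hdet (by positivity)
      _ = (‖τ‖ * S) ^ 2 := by ring
      _ ≤ (1 / 4) ^ 2 := pow_le_pow_left₀ (by positivity) h1 2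
      _ = 1 / 16 := by norm_num
  linarith

/-- A complex number within `½` of `1`: nonzero, in the slit plane, `½ ≤ ‖q‖ ≤ 3∕2`, `|arg q| ≤ π∕2`. [folklore] -/
theorem near_one_letters {q : ℂ} (hq : ‖q - 1‖ ≤ 1 / 2) : q ≠ 0 ∧ q ∈ slitPlane ∧ 1 / 2 ≤ ‖q‖ ∧ ‖q‖ ≤ 3 / 2 ∧ |q.arg| ≤ Real.pi / 2 := by
  have hre : 1 / 2 ≤ q.re := by
    have h := (abs_re_le_norm (q - 1)).trans hq
    rw [sub_re, one_re] at h
    linarith [neg_abs_le (q.re - 1)]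
  have hq0 : q ≠ 0 := fun h => by rw [h, zero_re] at hre; linarith
  refine ⟨hq0, Or.inl (by linarith), ?_, ?_, abs_arg_le_pi_div_two_iff.mpr (by linarith)⟩
  · have h := norm_sub_norm_le (1 : ℂ) q
    rw [norm_one, norm_sub_rev] at h
    linarith
  · have h := norm_le_norm_add_norm_sub' q 1
    rw [norm_one] at h
    linarith

/-- **`‖q^w‖ ≤ e^{3‖w‖}`** for `‖q − 1‖ ≤ ½` (principal power). [folklore] -/
theorem norm_cpow_le_exp_of_near_one {q : ℂ} (hq : ‖q - 1‖ ≤ 1 / 2) (w : ℂ) : ‖q ^ w‖ ≤ Real.exp (3 * ‖w‖) := by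
  obtain ⟨hq0, -, hlo, hhi, harg⟩ := near_one_letters hq
  have hqpos : 0 < ‖q‖ := by linarith
  rw [norm_cpow_of_ne_zero hq0, Real.rpow_def_of_pos hqpos, div_eq_mul_inv, ← Real.exp_neg, ← Real.exp_add]
  refine Real.exp_le_exp.mpr ?_
  have hlog : |Real.log ‖q‖| ≤ 1 := by
    rw [abs_le]
    constructor
    · have h := Real.one_sub_inv_le_log_of_pos hqpos
      have : ‖q‖⁻¹ ≤ 2 := by rw [inv_le_comm₀ hqpos (by norm_num)]; linarith
      linarith
    · linarith [Real.log_le_sub_one_of_pos hqpos]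
  have hre : |w.re| ≤ ‖w‖ := abs_re_le_norm w
  have him : |w.im| ≤ ‖w‖ := abs_im_le_norm w
  have h1 : Real.log ‖q‖ * w.re ≤ ‖w‖ := by
    have := abs_mul (Real.log ‖q‖) w.re
    nlinarith [le_abs_self (Real.log ‖q‖ * w.re), abs_nonneg (Real.log ‖q‖), abs_nonneg w.re]
  have h2 : -(q.arg * w.im) ≤ 2 * ‖w‖ := by
    have hπ : Real.pi / 2 ≤ 2 := by linarith [Real.pi_lt_four]
    have := abs_mul q.arg w.im
    nlinarith [neg_abs_le (q.arg * w.im), abs_nonneg q.arg, abs_nonneg w.im]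
  linarith

/-! ## §2 The scalar jets `(d∕dτ)^i det(1 + τΞ)^{w}|₀` -/

/-- `τ ↦ det(1 + τΞ)^c` is holomorphic on the disc `‖τ‖ < 1∕(4(1+S(Ξ)))`. [folklore] -/
theorem differentiableOn_detPow (Ξ : Matrix (Fin 2) (Fin 2) ℂ) (c : ℂ) :
    DifferentiableOn ℂ (fun τ : ℂ => (1 + τ • Ξ).det ^ c) (Metric.ball 0 (1 / (4 * (1 + (‖Ξ 0 0‖ + ‖Ξ 1 0‖ + ‖Ξ 0 1‖ + ‖Ξ 1 1‖))))) := by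
  intro τ hτ
  have hq := near_one_letters (norm_det_one_add_smul_sub_one_le Ξ (le_of_lt (mem_ball_zero_iff.mp hτ)))
  have hpoly : DifferentiableAt ℂ (fun τ : ℂ => (1 + τ • Ξ).det) τ := by
    have : (fun τ : ℂ => (1 + τ • Ξ).det) = fun τ => 1 + τ * Ξ.trace + τ ^ 2 * Ξ.det := funext (det_one_add_smul Ξ)
    rw [this]
    fun_prop
  exact (hpoly.cpow_const hq.2.1).differentiableWithinAt

/-- **THE SCALAR JETS ARE ENTIRE IN THE EXPONENT PARAMETER**: for an entire `w : ℂ → ℂ` and every `i`,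
`s ↦ (d∕dτ)^i det(1 + τΞ)^{w(s)} |_{τ=0}` is entire. [folklore] (engine (E)) -/
theorem differentiable_iteratedDeriv_detPow (Ξ : Matrix (Fin 2) (Fin 2) ℂ) {w : ℂ → ℂ} (hw : Differentiable ℂ w) (i : ℕ) :
    Differentiable ℂ (fun s : ℂ => iteratedDeriv i (fun τ : ℂ => (1 + τ • Ξ).det ^ w s) 0) := by
  set r : ℝ := 1 / (4 * (1 + (‖Ξ 0 0‖ + ‖Ξ 1 0‖ + ‖Ξ 0 1‖ + ‖Ξ 1 1‖))) with hr
  have hrpos : 0 < r := by positivity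
  rw [← differentiableOn_univ]
  refine differentiableOn_iteratedDeriv_of_param (G := fun s τ => (1 + τ • Ξ).det ^ w s) isOpen_univ hrpos
    (fun s _ => differentiableOn_detPow Ξ (w s)) (fun z hz => ?_) (fun K _ hK => ?_) i
  · -- holomorphy in `s` for fixed `τ = z`
    have hq := near_one_letters (norm_det_one_add_smul_sub_one_le Ξ hz.le)
    intro s _
    exact ((hw s).const_cpow (Or.inl hq.1)).differentiableWithinAt
  · -- local boundedness: `‖det(1+zΞ)^{w s}‖ ≤ e^{3‖w s‖} ≤ e^{3W}` on the compact `K`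
    obtain ⟨W, hW⟩ := hK.exists_bound_of_continuousOn hw.continuous.continuousOn
    refine ⟨Real.exp (3 * W), fun s hsK z hz => ?_⟩
    refine (norm_cpow_le_exp_of_near_one (norm_det_one_add_smul_sub_one_le Ξ hz.le) (w s)).trans ?_
    exact Real.exp_le_exp.mpr (by linarith [hW s hsK])

/-- **GROWTH OF THE SCALAR JETS**: `‖(d∕dτ)^i det(1 + τΞ)^{c}|₀‖ ≤ i! · e^{3‖c‖} · (8(1 + S(Ξ)))^i`. [folklore] (Cauchy) -/
theorem norm_iteratedDeriv_detPow_le (Ξ : Matrix (Fin 2) (Fin 2) ℂ) (c : ℂ) (i : ℕ) :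
    ‖iteratedDeriv i (fun τ : ℂ => (1 + τ • Ξ).det ^ c) 0‖ ≤
      i.factorial * Real.exp (3 * ‖c‖) * (8 * (1 + (‖Ξ 0 0‖ + ‖Ξ 1 0‖ + ‖Ξ 0 1‖ + ‖Ξ 1 1‖))) ^ i := by
  set S : ℝ := ‖Ξ 0 0‖ + ‖Ξ 1 0‖ + ‖Ξ 0 1‖ + ‖Ξ 1 1‖ with hS
  have hS0 : 0 ≤ S := by positivity
  set r : ℝ := 1 / (4 * (1 + S)) with hr
  have hrpos : 0 < r := by positivity
  have h := norm_iteratedDeriv_le_of_forall_norm_le (ρ := r / 2) (by positivity) (by linarith) (differentiableOn_detPow Ξ c)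
    (fun t ht => norm_cpow_le_exp_of_near_one (norm_det_one_add_smul_sub_one_le Ξ ht) c) i
  refine h.trans (le_of_eq ?_)
  have hρ : r / 2 = (8 * (1 + S))⁻¹ := by rw [hr]; field_simp; ring
  rw [hρ, inv_pow, div_eq_mul_inv, inv_inv]

/-! ## §3 The size of the bridge direction `(√h)⁻¹ Θ (√h)⁻¹` -/

/-- For `h > 0` (2×2): `P = (√h)⁻¹` is hermitian, `P·P = h⁻¹`, and `Σ_{ab} ‖P_{ab}‖² = tr h ∕ det h`. [folklore] -/
theorem sqrt_inv_letters {h : Matrix (Fin 2) (Fin 2) ℂ} (hh : h.PosDef) :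
    ((CFC.sqrt h)⁻¹)ᴴ = (CFC.sqrt h)⁻¹ ∧ (CFC.sqrt h)⁻¹ * (CFC.sqrt h)⁻¹ = h⁻¹ ∧
      ‖(CFC.sqrt h)⁻¹ 0 0‖ ^ 2 + ‖(CFC.sqrt h)⁻¹ 1 0‖ ^ 2 + ‖(CFC.sqrt h)⁻¹ 0 1‖ ^ 2 + ‖(CFC.sqrt h)⁻¹ 1 1‖ ^ 2 =
        ((h 0 0).re + (h 1 1).re) / ((h 0 0).re * (h 1 1).re - normSq (h 0 1)) := by
  set P : Matrix (Fin 2) (Fin 2) ℂ := (CFC.sqrt h)⁻¹ with hP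
  have hPh : Pᴴ = P := by rw [hP, conjTranspose_nonsing_inv, conjTranspose_sqrt]
  have hPP : P * P = h⁻¹ := by
    rw [hP, ← Matrix.mul_inv_rev, sqrt_mul_sqrt_of_posDef hh]
  refine ⟨hPh, hPP, ?_⟩
  -- entries of `h`: real diagonal, conjugate off-diagonal; `det h` real positive
  have h00 : h 0 0 = ((h 0 0).re : ℂ) := by
    have := hh.1.apply 0 0; rw [Complex.star_def] at this
    exact (Complex.conj_eq_iff_re.mp this).symm
  have h11 : h 1 1 = ((h 1 1).re : ℂ) := by
    have := hh.1.apply 1 1; rw [Complex.star_def] at this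
    exact (Complex.conj_eq_iff_re.mp this).symm
  have h10 : h 1 0 = conj (h 0 1) := by
    have := hh.1.apply 1 0; rw [Complex.star_def] at this
    exact this.symm
  have hdetC : h.det = (((h 0 0).re * (h 1 1).re - normSq (h 0 1) : ℝ) : ℂ) := by
    rw [det_fin_two, h10, Complex.mul_conj, h00, h11]
    push_cast
    simp only [ofReal_re]
  have hdet0 : 0 < (h 0 0).re * (h 1 1).re - normSq (h 0 1) := by
    have hd := hh.det_pos
    rw [hdetC, Complex.zero_lt_real] at hd
    exact hd
  have hdetne : h.det ≠ 0 := by rw [hdetC]; exact_mod_cast hdet0.ne'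
  -- `Σ ‖P_ab‖² = tr (P P) = tr h⁻¹`
  have hPba : ∀ a b : Fin 2, P b a = conj (P a b) := fun a b => by
    have := congrFun (congrFun hPh b) a
    rw [conjTranspose_apply, Complex.star_def] at this
    exact this.symm
  have hsq : ∀ a b : Fin 2, ((‖P a b‖ : ℝ) : ℂ) ^ 2 = P a b * P b a := fun a b => by
    rw [hPba a b, Complex.mul_conj, Complex.normSq_eq_norm_sq]
    push_cast
    ring
  have htr : (((‖P 0 0‖ ^ 2 + ‖P 1 0‖ ^ 2 + ‖P 0 1‖ ^ 2 + ‖P 1 1‖ ^ 2 : ℝ)) : ℂ) = (h⁻¹).trace := by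
    rw [← hPP, trace_fin_two, Matrix.mul_apply, Matrix.mul_apply, Fin.sum_univ_two, Fin.sum_univ_two]
    push_cast
    rw [hsq 0 0, hsq 1 0, hsq 0 1, hsq 1 1]
    ring
  -- `tr h⁻¹ = tr h ∕ det h` for 2×2
  have hinv : (h⁻¹).trace = (h 0 0 + h 1 1) / h.det := by
    rw [Matrix.inv_def, Ring.inverse_eq_inv', trace_smul, adjugate_fin_two, trace_fin_two]
    simp
    rw [div_eq_inv_mul]
    ring
  have key : (((‖P 0 0‖ ^ 2 + ‖P 1 0‖ ^ 2 + ‖P 0 1‖ ^ 2 + ‖P 1 1‖ ^ 2 : ℝ)) : ℂ) =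
      ((((h 0 0).re + (h 1 1).re) / ((h 0 0).re * (h 1 1).re - normSq (h 0 1)) : ℝ) : ℂ) := by
    rw [htr, hinv, hdetC, h00, h11]
    push_cast
    simp only [ofReal_re]
  exact_mod_cast key

/-- **THE SIZE OF THE BRIDGE DIRECTION**: for `h > 0` (2×2) and any `Θ`,
`S((√h)⁻¹ Θ (√h)⁻¹) ≤ 4 · S(Θ) · tr h ∕ det h`. [folklore] -/
theorem entrySum_bridgeDir_le {h : Matrix (Fin 2) (Fin 2) ℂ} (hh : h.PosDef) (Θ : Matrix (Fin 2) (Fin 2) ℂ) :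
    ‖((CFC.sqrt h)⁻¹ * Θ * (CFC.sqrt h)⁻¹) 0 0‖ + ‖((CFC.sqrt h)⁻¹ * Θ * (CFC.sqrt h)⁻¹) 1 0‖ +
        ‖((CFC.sqrt h)⁻¹ * Θ * (CFC.sqrt h)⁻¹) 0 1‖ + ‖((CFC.sqrt h)⁻¹ * Θ * (CFC.sqrt h)⁻¹) 1 1‖ ≤
      4 * (‖Θ 0 0‖ + ‖Θ 1 0‖ + ‖Θ 0 1‖ + ‖Θ 1 1‖) * (((h 0 0).re + (h 1 1).re) / ((h 0 0).re * (h 1 1).re - normSq (h 0 1))) := by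
  obtain ⟨-, -, hsum⟩ := sqrt_inv_letters hh
  set P : Matrix (Fin 2) (Fin 2) ℂ := (CFC.sqrt h)⁻¹ with hP
  set T : ℝ := ‖Θ 0 0‖ + ‖Θ 1 0‖ + ‖Θ 0 1‖ + ‖Θ 1 1‖ with hT
  have hT0 : 0 ≤ T := by positivity
  have hΘle : ∀ c d : Fin 2, ‖Θ c d‖ ≤ T := by
    intro c d
    fin_cases c <;> fin_cases d <;> simp only [hT, Fin.zero_eta, Fin.mk_one, Fin.isValue] <;>
      linarith [norm_nonneg (Θ 0 0), norm_nonneg (Θ 1 0), norm_nonneg (Θ 0 1), norm_nonneg (Θ 1 1)]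
  -- entrywise: `‖(PΘP)_{ab}‖ ≤ T (‖P_{a0}‖ + ‖P_{a1}‖)(‖P_{0b}‖ + ‖P_{1b}‖)`
  have hent : ∀ a b : Fin 2, ‖(P * Θ * P) a b‖ ≤ T * ((‖P a 0‖ + ‖P a 1‖) * (‖P 0 b‖ + ‖P 1 b‖)) := by
    intro a b
    have hexp : (P * Θ * P) a b = P a 0 * Θ 0 0 * P 0 b + P a 0 * Θ 0 1 * P 1 b + P a 1 * Θ 1 0 * P 0 b + P a 1 * Θ 1 1 * P 1 b := by
      simp only [Matrix.mul_apply, Fin.sum_univ_two]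
      ring
    rw [hexp]
    have hterm : ∀ c d : Fin 2, ‖P a c * Θ c d * P d b‖ ≤ T * (‖P a c‖ * ‖P d b‖) := fun c d => by
      rw [norm_mul, norm_mul]
      have := hΘle c d
      nlinarith [norm_nonneg (P a c), norm_nonneg (P d b), mul_nonneg (norm_nonneg (P a c)) (norm_nonneg (P d b))]
    refine (norm_add_le _ _).trans ((add_le_add ((norm_add_le _ _).trans (add_le_add ((norm_add_le _ _).trans
      (add_le_add (hterm 0 0) (hterm 0 1))) (hterm 1 0))) (hterm 1 1)).trans (le_of_eq ?_))
    ring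
  have p00 := norm_nonneg (P 0 0); have p01 := norm_nonneg (P 0 1); have p10 := norm_nonneg (P 1 0); have p11 := norm_nonneg (P 1 1)
  -- sum and Cauchy–Schwarz: `S(PΘP) ≤ T S(P)² ≤ 4T Σ‖P‖²`
  have hR : 0 ≤ ((h 0 0).re + (h 1 1).re) / ((h 0 0).re * (h 1 1).re - normSq (h 0 1)) := by rw [← hsum]; positivity
  calc ‖(P * Θ * P) 0 0‖ + ‖(P * Θ * P) 1 0‖ + ‖(P * Θ * P) 0 1‖ + ‖(P * Θ * P) 1 1‖
      ≤ T * ((‖P 0 0‖ + ‖P 0 1‖) * (‖P 0 0‖ + ‖P 1 0‖)) + T * ((‖P 1 0‖ + ‖P 1 1‖) * (‖P 0 0‖ + ‖P 1 0‖)) +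
          T * ((‖P 0 0‖ + ‖P 0 1‖) * (‖P 0 1‖ + ‖P 1 1‖)) + T * ((‖P 1 0‖ + ‖P 1 1‖) * (‖P 0 1‖ + ‖P 1 1‖)) :=
        add_le_add (add_le_add (add_le_add (hent 0 0) (hent 1 0)) (hent 0 1)) (hent 1 1)
    _ = T * (‖P 0 0‖ + ‖P 1 0‖ + ‖P 0 1‖ + ‖P 1 1‖) ^ 2 := by ring
    _ ≤ T * (4 * (‖P 0 0‖ ^ 2 + ‖P 1 0‖ ^ 2 + ‖P 0 1‖ ^ 2 + ‖P 1 1‖ ^ 2)) := by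
        refine mul_le_mul_of_nonneg_left ?_ hT0
        nlinarith [sq_nonneg (‖P 0 0‖ - ‖P 1 0‖), sq_nonneg (‖P 0 0‖ - ‖P 0 1‖), sq_nonneg (‖P 0 0‖ - ‖P 1 1‖),
          sq_nonneg (‖P 1 0‖ - ‖P 0 1‖), sq_nonneg (‖P 1 0‖ - ‖P 1 1‖), sq_nonneg (‖P 0 1‖ - ‖P 1 1‖)]
    _ = 4 * T * (((h 0 0).re + (h 1 1).re) / ((h 0 0).re * (h 1 1).re - normSq (h 0 1))) := by rw [hsum]; ring

end Summit.HodgeConjecture.HodgeConjecture.Cruxes.HLiu418.K2LiuBridgeDirectionLetters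

end
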